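import Summits.ABC.IUTFork.Repair.CandInternal34
import Summits.ABC.IUTFork.Cor312PilotKummerSplitWitness
import HarnessLib

/-!
# IUT REPAIR branch (rung LADDER-ABC:A2.RP), sub-cell B0 class (i) INTERNAL, file `CandInternal43` (abc-iut-rp-d1, gen 2): the d1 rows on
# abc-iut-w5-d230's SPLIT natural bed P♮₁ — where S holds through print's OWN mover, an (Ind1) CAPSULE PERMUTATION, and Ism is trivial.
# The ⟨Ind2⟩-restricted class-(i) suppliers (RP-I03a/I13 with RF1; Λ-bound form C₂) FAIL there while C and S hold — STRICTLY STRONGER than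
# print's datum clause —; the roots-of-unity row RP-I19 `HTor` HOLDS there (a transposition has order 2)

Proof-only record file (D-0012; 0 definitions, 0 `Prop` facts, standard axioms) of the abc-iut cell's IUT REPAIR branch (seat abc-iut-rp-d1, k = 43 ≡ 1
(mod 3); REPAIR-SPEC v0.5 §3 PROFILE: bed P♮₁). TAKES NO SIDE on [IUTchIII] Cor. 3.12 or on any author; candidates stay hypotheses; typed ≠ proved;
instantiated ≠ endorsed. Consumed BY NAME: P♮₁ = `SplitWitness.splitFull` / `splitSetting` / `boxRegion` / `qDatumSplit := swapFamily · {thetaStar}`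
(`Cor312PilotKummerSplit{Shells,Model,Thm311,Witness}`: two valuations over one place, TRIVIAL Ism and strip-automorphisms, the (Ind1)-family
`swapFamily` = swap of the capsule indices `0` and `j` carries the Θ-box onto the DISTINCT q-box; typed Thm. 3.11, three pins, S, `PilotKummerCompat`,
STRICT Statement, ¬IdentifiedReading — [IUTchIII] Thm. 3.11 (i) (Ind1) p.154; [IUTchIV] Thm. 1.10 Step (v); [cite: DupuyHilado2020, §4.7]); the rows
`CandInternal1.H`/`Hins` (RP-I03a/b), `CandInternal10.H` (RP-I13), `CandInternal34.HTor` (RP-I19).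

## RESULTS (kernel, this file)
* **§1** On the split shells ⟨Ind2⟩ ACTS TRIVIALLY (`apply_eq_of_mem_closure_Ind2`: Ism = {1}); `swapFamily` is an involution (`swapFamily_swapFamily`).
* **§2 `not_linkTransport_split_of_subset_closure_Ind2`**: for every coric `Λ ⊆ ⟨Ind2⟩` and every setting over `splitFull`, RF1 FAILS (it would
  say `qDatumSplit = {thetaStar}`, abc-iut-w5-d230 `qDatumSplit_ne_theta`). Hence **`C2_fails_at_split`: the Λ-bound class-(i) supplier
  C₂ := «∃ Φ ∈ ⟨Ind2⟩, ∃ m₀, qK = Φ · frobΨ_n m₀» (`CandInternal10.exists_candInternal1H_and_linkTransport_iff`) is FALSE at P♮₁ while print's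
  C = `PilotKummerCompat` (Φ ranging over ⟨(Ind1)∪(Ind2)⟩) and S HOLD** (`C2_strictly_stronger_than_C_at_split`): restricting the transporter to
  Ism-type indeterminacies — which is what the [EtTh]/Rmk 2.2.x sentences speak about — EXCLUDES print's own (Ind1) mechanism (the cell abc-iut-rp-d3
  found for RP-I15, `I15_strictly_stronger_than_C`, now for the whole d1 coric family).
* For the transporting family `Λ = {swapFamily}` (∈ (Ind1)): RF1 HOLDS, (LI) `Λ ⊆ ⟨(Ind1)∪(Ind2)⟩` HOLDS, RP-I13 FAILS (`swapFamily ∉ ⟨Ind2⟩`), RP-I03a `H`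
  FAILS, RP-I03b `Hins` FAILS, and **RP-I19 `HTor` HOLDS** (`N = 2`). So **`satSplit_HTor_linkSubInd` — SAT♮ at P♮₁ for «HTor ∧ (LI) ∧ RF1»**, the
  class-(i) roots-of-unity reading joined with abc-iut-w5-d155's (L)+(LI) instead of RP-I13: it holds on BOTH print-shaped escapes (P♮: sign; P♮₁:
  capsule permutation), and `CandInternal34.not_HTor_and_transport_scal` still excludes door (b). (T-a of that conjunction is w5-d155's route,
  `pilotKummerCompat_of_linkSubInd_transport`, with `HTor` idle — honesty flag as in `CandInternal34`.)
READING (neutral; census ≠ verdict): of the two [EtTh]-motivated typings, the ISM-RESTRICTION (RP-I03a/I13: «the transporter is an ⟨Ind2⟩-element»)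
is strictly stronger than print's clause and false on print's own (Ind1) bed, whereas the FINITE-ORDER typing (RP-I19 `HTor`) is consistent with
every isometric escape of record (P♮, P♮₁, CV) and inconsistent exactly with door (b). No side taken on which, if either, print intends.
-/

noncomputable section

open Set

namespace Summit.ABC.IUTFork.Repair

open Thm311 Cor312 Cor312Vol Literature.IUT.LogThetaLattice

namespace CandInternal43

open Cor312.Checks Cor312.IdentifiedNonVacuity NaiveWitness PinnedWitness SplitWitness

/-! ## 1. Split shells: ⟨Ind2⟩ acts trivially; the capsule swap is an involution -/

/-- **On the split shells every element of ⟨Ind2⟩ acts as the IDENTITY on every packet** (Ism = strip-automorphisms = `{1}`). [folklore] -/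
theorem apply_eq_of_mem_closure_Ind2 {Φ : splitShells.PacketAut} (h : Φ ∈ Subgroup.closure splitShells.Ind2Family)
    (j : splitIndex.Label) (vQ : splitIndex.VQ) (x : splitShells.Packet j vQ) : Φ j vQ x = x := by
  induction h using Subgroup.closure_induction generalizing x with
  | mem Ψ hΨ =>
    obtain ⟨g, hg, hΨj⟩ := hΨ j vQ
    rw [hΨj]
    have hs : (fun i => splitShells.summandwise vQ (g i)) = fun _ => LinearEquiv.refl ℚ (splitShells.Packet1 vQ) :=
      funext fun i => summandwise_refl' vQ _ fun v => hg i v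
    rw [hs, splitShells.factorwise_refl]
    rfl
  | one => rfl
  | mul Ψ Ψ' _ _ hΨ hΨ' =>
    show Ψ j vQ (Ψ' j vQ x) = x
    rw [hΨ', hΨ]
  | inv Ψ _ hΨ =>
    show (Ψ j vQ).symm x = x
    rw [LinearEquiv.symm_apply_eq, hΨ]

/-- … hence fixes every bad-place datum set-wise. [folklore] -/
theorem image_eq_of_mem_closure_Ind2 {Φ : splitShells.PacketAut} (h : Φ ∈ Subgroup.closure splitShells.Ind2Family)
    (v : splitIndex.V) (X : Set (splitShells.StarPacket v)) : splitShells.starAut Φ v '' X = X := by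
  have hid : ∀ f : splitShells.StarPacket v, splitShells.starAut Φ v f = f := fun f =>
    funext fun j => apply_eq_of_mem_closure_Ind2 h j.1 (splitIndex.over v) (f j)
  ext f
  constructor
  · rintro ⟨g, hg, rfl⟩; rw [hid]; exact hg
  · intro hf; exact ⟨f, hf, hid f⟩

/-- **The capsule swap is an involution** on every packet (`swap ∘ swap = id`, `PiTensorProduct.reindex_reindex`). [folklore] -/
theorem swapFamily_swapFamily (j : splitIndex.Label) (vQ : splitIndex.VQ) (x : splitShells.Packet j vQ) :
    swapFamily j vQ (swapFamily j vQ x) = x := by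
  rw [swapFamily_mem_indGroup.2 j vQ, swapFamily_mem_indGroup.2 j vQ]
  refine (PiTensorProduct.reindex_reindex (swapLast j) (swapLast j) x).trans ?_
  unfold swapLast
  rw [Equiv.swap_swap, PiTensorProduct.reindex_refl]
  rfl

/-- … so `swapFamily²` fixes every bad-place datum set-wise. [folklore] -/
theorem image_starAut_swapFamily_sq (v : splitIndex.V) (X : Set (splitShells.StarPacket v)) :
    splitShells.starAut (swapFamily ^ 2) v '' X = X := by
  have hid : ∀ f : splitShells.StarPacket v, splitShells.starAut (swapFamily ^ 2) v f = f := fun f => by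
    funext j
    show (swapFamily ^ 2) j.1 (splitIndex.over v) (f j) = f j
    rw [Pi.pow_apply, Pi.pow_apply, pow_two, LinearEquiv.mul_apply, swapFamily_swapFamily]
  ext f
  constructor
  · rintro ⟨g, hg, rfl⟩; rw [hid]; exact hg
  · intro hf; exact ⟨f, hf, hid f⟩

/-! ## 2. The d1 rows at P♮₁ -/

/-- **RF1 FAILS at P♮₁ for every coric `Λ ⊆ ⟨Ind2⟩`** (every setting over `splitFull`): a coric transporter acts trivially, so RF1 would identify
the q-datum with the Θ-datum (`qDatumSplit_ne_theta`). [folklore] -/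
theorem not_linkTransport_split_of_subset_closure_Ind2 (P : Cor312.Setting splitFull.toLatticeSituation.toSituation)
    {Λ : Set splitShells.PacketAut} (hΛ : Λ ⊆ (Subgroup.closure splitShells.Ind2Family : Set splitShells.PacketAut)) :
    ¬ ∃ Φ₀ ∈ Λ, ∃ m₀ : ℤ, ∀ (v : splitIndex.V) (hv : v ∈ splitIndex.Vbad),
      qDatumSplit v hv = splitShells.starAut Φ₀ v '' (splitFull.toLatticeSituation.col P.n).frobΨ m₀ v hv := by
  rintro ⟨Φ₀, hΦ₀, m₀, hq⟩
  have h1 := hq true rfl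
  change qDatumSplit true rfl = splitShells.starAut Φ₀ true '' {thetaStar true} at h1
  rw [image_eq_of_mem_closure_Ind2 (hΛ hΦ₀)] at h1
  exact qDatumSplit_ne_theta h1

/-- **`C2_fails_at_split` — the Λ-bound class-(i) supplier is FALSE at P♮₁**: there is NO `Φ ∈ ⟨Ind2⟩` and `m₀` with `qK = Φ · frobΨ_n m₀`
(the form to which RP-I03a/RP-I13 ∧ RF1 collapse, `CandInternal10.exists_candInternal1H_and_linkTransport_iff`). [folklore] -/
theorem C2_fails_at_split (P : Cor312.Setting splitFull.toLatticeSituation.toSituation) :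
    ¬ ∃ Φ ∈ Subgroup.closure splitShells.Ind2Family, ∃ m₀ : ℤ, ∀ (v : splitIndex.V) (hv : v ∈ splitIndex.Vbad),
      qDatumSplit v hv = splitShells.starAut Φ v '' (splitFull.toLatticeSituation.col P.n).frobΨ m₀ v hv := by
  rintro ⟨Φ, hΦ, m₀, hq⟩
  exact not_linkTransport_split_of_subset_closure_Ind2 P (Λ := {Φ}) (by rintro _ rfl; exact hΦ) ⟨Φ, rfl, m₀, hq⟩

/-- **`C2_strictly_stronger_than_C_at_split`** — at P♮₁ (typed Thm 3.11, BridgeHyps, `|log(q)| > 0`, three pins): print's datum clause C =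
`PilotKummerCompat` HOLDS (transporter `swapFamily ∈ (Ind1)`), S HOLDS, the Statement holds STRICTLY, ¬IdentifiedReading — and C₂ FAILS, i.e.
RP-I03a ∧ RF1 and RP-I13 ∧ RF1 fail for EVERY coric `Λ`. The ⟨Ind2⟩-restriction is STRICTLY STRONGER than print's clause on print's own (Ind1) bed.
[claim: Mochizuki2012, status: disputed] -/
theorem C2_strictly_stronger_than_C_at_split :
    splitFull.Statement ∧ BridgeHyps splitSetting ∧ splitSetting.AbsLogQPos ∧
      PinnedRegions3 splitFull.toLatticeSituation splitSetting boxRegion qDatumSplit ∧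
      PilotKummerCompat splitFull.toLatticeSituation splitSetting qDatumSplit ∧
      PilotKummerIndRelated splitFull.toLatticeSituation splitSetting boxRegion qDatumSplit ∧
      splitSetting.Statement ∧ ((splitSetting.negLogQ : ℝ) : WithTop ℝ) < splitSetting.negLogTheta ∧ ¬ splitSetting.IdentifiedReading ∧
      (¬ ∃ Φ ∈ Subgroup.closure splitShells.Ind2Family, ∃ m₀ : ℤ, ∀ (v : splitIndex.V) (hv : v ∈ splitIndex.Vbad),
        qDatumSplit v hv = splitShells.starAut Φ v '' (splitFull.toLatticeSituation.col splitSetting.n).frobΨ m₀ v hv) ∧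
      (∀ Λ : Set splitShells.PacketAut, CandInternal10.H splitFull.toLatticeSituation Λ →
        ¬ ∃ Φ₀ ∈ Λ, ∃ m₀ : ℤ, ∀ (v : splitIndex.V) (hv : v ∈ splitIndex.Vbad),
          qDatumSplit v hv = splitShells.starAut Φ₀ v '' (splitFull.toLatticeSituation.col splitSetting.n).frobΨ m₀ v hv) :=
  ⟨splitFull_statement, splitSetting_bridgeHyps, splitSetting_absLogQPos, splitSetting_pinnedRegions3, splitSetting_pilotKummerCompat,
    splitSetting_pilotKummerIndRelated, splitSetting_statement_strict.1, splitSetting_statement_strict.2, splitSetting_not_identifiedReading,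
    C2_fails_at_split splitSetting, fun _ hΛ => not_linkTransport_split_of_subset_closure_Ind2 splitSetting hΛ⟩

/-- **The transporting family is NOT coric at P♮₁**: `swapFamily ∉ ⟨Ind2⟩` (it moves the Θ-point; ⟨Ind2⟩ acts trivially) — RP-I13 FAILS for
`Λ = {swapFamily}`. [folklore] -/
theorem not_candInternal10H_swap : ¬ CandInternal10.H splitFull.toLatticeSituation {swapFamily} := fun h => by
  have hmem : swapFamily ∈ (Subgroup.closure splitShells.Ind2Family : Set splitShells.PacketAut) := h rfl
  have hj := Setting.labelSucc_ne_zero (⟨0, by decide⟩ : Fin splitIndex.lstar)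
  exact swapFamily_thetaPt_ne hj () (apply_eq_of_mem_closure_Ind2 hmem _ () _)

/-- **RP-I03a `H` FAILS at P♮₁ for `Λ = {swapFamily}`** (an ⟨Ind2⟩-translate of the Θ-datum is the Θ-datum itself, which the swap moves).
[folklore] -/
theorem not_H_split_swap (P : Cor312.Setting splitFull.toLatticeSituation.toSituation) :
    ¬ CandInternal1.H splitFull.toLatticeSituation P {swapFamily} := fun h => by
  obtain ⟨Φ', hΦ', hΦ'eq⟩ := h swapFamily rfl 0
  have h1 := hΦ'eq true rfl
  change splitShells.starAut swapFamily true '' {thetaStar true} = splitShells.starAut Φ' true '' {thetaStar true} at h1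
  rw [image_eq_of_mem_closure_Ind2 hΦ'] at h1
  exact qDatumSplit_ne_theta h1

/-- RP-I03b `Hins` FAILS at P♮₁ for `Λ = {swapFamily}` (a fortiori). [folklore] -/
theorem not_Hins_split_swap (P : Cor312.Setting splitFull.toLatticeSituation.toSituation) :
    ¬ CandInternal1.Hins splitFull.toLatticeSituation P {swapFamily} := fun h =>
  not_H_split_swap P (CandInternal1.H_of_Hins _ _ _ h)

/-- **RP-I19 `HTor` HOLDS at P♮₁ for the transporting family** (`N = 2`: the swap is an involution) — and for every `Λ ⊆ ⟨Ind2⟩` (`N = 1`).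
[folklore] -/
theorem HTor_split_swap (P : Cor312.Setting splitFull.toLatticeSituation.toSituation) :
    CandInternal34.HTor splitFull.toLatticeSituation P {swapFamily} := by
  rintro _ rfl
  exact ⟨2, two_pos, fun m v hv => image_starAut_swapFamily_sq v _⟩

/-- `HTor` for coric `Λ ⊆ ⟨Ind2⟩` at P♮₁ (trivial action, `N = 1`). [folklore] -/
theorem HTor_split_of_subset_closure_Ind2 (P : Cor312.Setting splitFull.toLatticeSituation.toSituation) {Λ : Set splitShells.PacketAut}
    (hΛ : Λ ⊆ (Subgroup.closure splitShells.Ind2Family : Set splitShells.PacketAut)) :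
    CandInternal34.HTor splitFull.toLatticeSituation P Λ := fun Φ hΦ =>
  ⟨1, one_pos, fun m v hv => by rw [pow_one]; exact image_eq_of_mem_closure_Ind2 (hΛ hΦ) v _⟩

/-- RF1 HOLDS at P♮₁ for `Λ = {swapFamily}` (by definition of the q-datum), and (LI) holds: `swapFamily ∈ ⟨(Ind1)∪(Ind2)⟩`. [folklore] -/
theorem linkTransport_split_swap (P : Cor312.Setting splitFull.toLatticeSituation.toSituation) :
    (∃ Φ₀ ∈ ({swapFamily} : Set splitShells.PacketAut), ∃ m₀ : ℤ, ∀ (v : splitIndex.V) (hv : v ∈ splitIndex.Vbad),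
      qDatumSplit v hv = splitShells.starAut Φ₀ v '' (splitFull.toLatticeSituation.col P.n).frobΨ m₀ v hv) ∧
    ({swapFamily} : Set splitShells.PacketAut) ⊆ Subgroup.closure (splitShells.Ind1Family ∪ splitShells.Ind2Family) :=
  ⟨⟨swapFamily, rfl, 0, fun _ _ => rfl⟩, by rintro _ rfl; exact swapFamily_mem_indGroup.1⟩

/-! ## 3. The refined joint supplier «HTor ∧ (LI) ∧ RF1»: model-free T-a, SAT♮ on BOTH print-shaped beds -/

section General

variable {T : ThetaIndex} (S : LatticeSituation T) (P : Cor312.Setting S.toSituation)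
  (qK : ∀ v : T.V, v ∈ T.Vbad → Set (S.L.StarPacket v)) (Λ : Set S.L.PacketAut)

/-- **(T-a, model-free; HONESTY FLAG: `HTor` IDLE)** — abc-iut-w5-d155's route: (LI) `Λ ⊆ ⟨(Ind1)∪(Ind2)⟩` ∧ RF1 ⟹ `PilotKummerCompat`; `HTor`
rides along as the door-(b) discriminator (`CandInternal34.not_HTor_and_transport_scal`). [claim: Mochizuki2012, status: disputed] -/
theorem pilotKummerCompat_of_linkSubInd_transport (_hTor : CandInternal34.HTor S P Λ)
    (hLI : Λ ⊆ (Subgroup.closure (S.L.Ind1Family ∪ S.L.Ind2Family) : Set S.L.PacketAut))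
    (RF1 : ∃ Φ₀ ∈ Λ, ∃ m₀ : ℤ, ∀ (v : T.V) (hv : v ∈ T.Vbad), qK v hv = S.L.starAut Φ₀ v '' (S.col P.n).frobΨ m₀ v hv) :
    PilotKummerCompat S P qK := by
  obtain ⟨Φ₀, hΦ₀, m₀, hq⟩ := RF1
  exact ⟨Φ₀, hLI hΦ₀, m₀, hq⟩

end General

/-- **`satSplit_HTor_linkSubInd` — SAT♮ at P♮₁ for «HTor ∧ (LI) ∧ RF1»** with the transporting family `{swapFamily}`: typed Thm 3.11, BridgeHyps,
`|log(q)| > 0`, three pins, `HTor`, (LI), RF1, `PilotKummerCompat`, S, hull clause, STRICT Statement, ¬IdentifiedReading — while RP-I13, RP-I03a `H`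
and RP-I03b `Hins` FAIL for that family (abc-iut-w5-d230's engine `satNatural₁_of_holds_at_splitSetting`). [claim: Mochizuki2012, status: disputed] -/
theorem satSplit_HTor_linkSubInd :
    ∃ (T : ThetaIndex) (F : FullSituation T) (P : Cor312.Setting F.toLatticeSituation.toSituation)
      (ρ : (∀ v : T.V, v ∈ T.Vbad → Set (F.L.StarPacket v)) → ∀ (j : T.Label) (vQ : T.VQ), Set (F.L.Packet j vQ))
      (qK : ∀ v : T.V, v ∈ T.Vbad → Set (F.L.StarPacket v)),
      F.Statement ∧ BridgeHyps P ∧ P.AbsLogQPos ∧ PinnedRegions3 F.toLatticeSituation P ρ qK ∧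
        (∃ Λ : Set F.L.PacketAut, CandInternal34.HTor F.toLatticeSituation P Λ ∧
          Λ ⊆ (Subgroup.closure (F.L.Ind1Family ∪ F.L.Ind2Family) : Set F.L.PacketAut) ∧
          (∃ Φ₀ ∈ Λ, ∃ m₀ : ℤ, ∀ (v : T.V) (hv : v ∈ T.Vbad),
            qK v hv = F.L.starAut Φ₀ v '' (F.toLatticeSituation.col P.n).frobΨ m₀ v hv) ∧
          ¬ CandInternal10.H F.toLatticeSituation Λ ∧ ¬ CandInternal1.H F.toLatticeSituation P Λ) ∧
        PilotKummerCompat F.toLatticeSituation P qK ∧ PilotKummerCompatRegion F.toLatticeSituation P ρ qK ∧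
        PilotKummerIndRelated F.toLatticeSituation P ρ qK ∧ PilotKummerCompatHull F.toLatticeSituation P ρ qK ∧
        P.Statement ∧ ((P.negLogQ : ℝ) : WithTop ℝ) < P.negLogTheta ∧ ¬ P.IdentifiedReading :=
  satNatural₁_of_holds_at_splitSetting
    (fun S P _ qK => ∃ Λ : Set S.L.PacketAut, CandInternal34.HTor S P Λ ∧
      Λ ⊆ (Subgroup.closure (S.L.Ind1Family ∪ S.L.Ind2Family) : Set S.L.PacketAut) ∧
      (∃ Φ₀ ∈ Λ, ∃ m₀ : ℤ, ∀ v hv, qK v hv = S.L.starAut Φ₀ v '' (S.col P.n).frobΨ m₀ v hv) ∧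
      ¬ CandInternal10.H S Λ ∧ ¬ CandInternal1.H S P Λ)
    ⟨{swapFamily}, HTor_split_swap splitSetting, (linkTransport_split_swap splitSetting).2, (linkTransport_split_swap splitSetting).1,
      not_candInternal10H_swap, not_H_split_swap splitSetting⟩

end CandInternal43

end Summit.ABC.IUTFork.Repair

end
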